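import Summits.QuantumFields.BalabanUV.T4Continuum.Support.NE4ReadOutSocketGaussian

/-!
# NE4ReadOutSocketGaussianSpine — row NE4 IN THE SPINE on t-histories: the `K`-uniform term-wise matching `URateUpTo K`
# with node U2 fed by row NE9's END (coupling channel PRODUCED from Gaussian letters) and row NE5's END, BY NAME
# (cell `pub-balaban`, T⁴-continuum fan-out, `HOME/BINDER-OWNERS.md` row NE4 = node U2, owner lineage t4-ne4-p1, gen 33;
# the third face of the t-currency booking, companion of `NE4ReadOutSocketGaussian` §1–§2)

HONEST FRAMING (T4-DAG PAGE 1).  Rung (B)+1 on a FIXED finite torus — NOT infinite volume, NOT a mass gap, NOT the Clay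
problem.  NE4 (η-rate of the full β_k), NE5, NE9 are cell NEW ESTIMATES, NOT PRINTED in [Balaban1987RG1]–[Balaban1989LargeFieldII],
NOT PROVED here (0/9, unchanged): node U2 is DEPENDENT = (R)∘{NE5, NE9}.  Every analytic input is a DISPLAYED binder;
`FlowStep.BetaPertH`, (B), (B^μ) live in the windows `W`/`Wt` and the runs of whoever instantiates and are NOT hidden.
Nothing printed is asserted; 0 cite tags.  HONEST DEPENDENCY (cell, verbatim): continuum YM on T⁴ ⇐ BetaPertH ∧ nine spine
estimates (0/9 proved); BetaPertH ⇐ (D1) ∧ (D4) ∧ CAP+tail; G-an2-4 gates asym, D1 and NE2/3/4.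

WHAT THIS MODULE IS.  `NE4ReadOutSocket` §3 (p202738) closes the spine's `URateUpTo K` in the g-currency by
`T4TowerRateDischarge.uRateUpTo_of_nodes` (node U2's output `InjectedRate` converted to a COUPLING rate with the factor `γ³`,
`couplingRate_pair_of_injectedDisc`).  On t-HISTORIES — the currency forced by the Gaussian letters of the coupling channel
(`NE4GaussianCouplingTwoPoint`, `NE4ReadOutSocketGaussian`) — node U2's native output IS the t-coupling rate with the SAME
constant (`T4CurrencyMatching.couplingRateT_of_injectedDisc`, no `γ³`), and the tower composition is parametrisation-agnostic
(`T4TowerRateDischarge.uRateUpTo_tower_anyRate`).  So: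
* §0 `uRateUpToT_of_nodes` — the t-analogue of `T4TowerRateDischarge.uRateUpTo_of_nodes` (same ten-line proof with the
  t-runs `n ↦ (g K n)⁻²`, `n ↦ (g (K+1) (n+1))⁻²` and `couplingRateT_of_injectedDisc`): NE9 ∧ FadingMemory, node U1b
  (`LipBackground`, `PolyLipGrowth` on the t-runs), NE5, nodes U5/U6 (`LocalRate`, `GaugeDominated`), node U2's output
  `InjectedRate Cd 0 θc (disc …)`, the t-runs in `Wt`, a target rate `θ′ > max ω θc` ⇒ `∃ a ≥ 0, ∀ K, URateUpTo K … (a +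
  C₉·Cd·θ′/(θ′ − max ω θc) + C₅) θ′ κ` — constant WITHOUT `γ³` (cf. `T4CurrencyMatching.uRateUpTo_towerT`, the raw-bracket form).
* §1 `uRateUpToT_of_gaussNE9_endNE5` — END TO END: the binders of `NE4ReadOutSocketGaussian.injectedRate_of_gaussNE9_endNE5`
  ((GAUSS) + row NE9's END rest + row NE5's END for the read-out family + (R) on classes + runs/box/pin + memory gap + window,
  weight 1) for node U2's output, PLUS row NE5's END for the TOWER PAIR (`Et`, `EBt`) over `Wt` through ONE step model `M`
  (W1 entrywise, W4 posited; scalars shared with the family), node U1b on the t-runs, nodes U5/U6, the t-runs in `Wt`, and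
  `θ′ > max ν ρ`, `θ₅, θ₃ ≤ θ′` ⇒ the spine's `K`-UNIFORM `URateUpTo K` for the t-parametrised families with constant
  `a + (ℓ/ν)·(2(cr·C₅·θ₅)/(1 − ρ))·θ′/(θ′ − max ν ρ) + C₅`.
* §2 (v1.1, gen 34, APPEND-ONLY) `betaContH_of_histLipschitzBy` / `betaContH_of_histLipschitzT` / `betaContH_of_ne4T` — the
  headline's OTHER β-binder `hC : FlowStep.BetaContH γ β` of `T4ContinuumYM4Torus.continuumYM4_torus_of_BetaPertH` from node
  U2's history moduli in ANY currency `φ` continuous on ]0,γ] (squeeze; no Lipschitz bound on `φ`, no sign on the moduli), in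
  particular from the t-triple of `NE4ReadOutSocketGaussian.ne4T_of_gaussNE9_endNE5` — the t-moduli are NOT g-Lipschitz at
  the vertex, so the g-booking's `T4BetaStationary.betaContH_of_histLipschitz` does not apply, continuity of `invSq` does.

WHAT REMAINS DISPLAYED: as `NE4ReadOutSocketGaussian` (NE9 side: table channel `TwoPointKP`, `hTcup`, explicit part,
`DecayExtract`/`PinBudget`, `hocc`, and per index the Gaussian letters + the two (2.38)-majorant comparisons; NE5 side: W1–W4/
MI-R twice (family and tower pair); (R); runs/box/pin; memory gap; window) plus node U1b, nodes U5/U6 and `θ′`.  WHAT IS PROVED: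
bookkeeping (compositions BY NAME; one `positivity`; §2 one squeeze argument).  0 sorry; axioms ⊆ {propext, Classical.choice, Quot.sound}; imports
`Support/NE4ReadOutSocketGaussian` (p205112) only, modifies nothing.  NOT COVERED: any binder instance for Bałaban's objects;
NE2, NE3, NE5, NE9, BetaPertH.  Rung (B)+1 finite T⁴; NOT summit progress.
-/

noncomputable section

namespace Summit.QuantumFields.BalabanUV.T4Continuum.NE4ReadOutSocketGaussianSpine

open MeasureTheory ProbabilityTheory
open scoped BigOperators RealInnerProductSpace
open Literature.MathematicalPhysics.QuantumFieldTheory.Balaban1983to89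
open FlowStep (HBeta RGEqH Box)
open T4OutputRate (Carriers Functional NE5 NE9 LipBackground DecayBound)
open T4CouplingMatching (disc ScaleShiftRate)
open T4CauchySum (InjectedRate)
open T4EtaRateMin (Readings LocalRate)
open T4RateLiaison (GaugeDominated)
open T4TowerRateComposition (URateUpTo PolyLipGrowth argBracket_tower)
open T4TowerRateDischarge (uRateUpTo_tower_anyRate closeness_of_localRate)
open T4CurrencyMatching (HistLipschitzBy invSq reparam couplingRateT_of_injectedDisc)
open T4BetaReadOut (Slice ReadOut RepresentsA RepresentsB)
open T4BetaReadOutLipschitz (ReadBoundedOn ReadCovariantOn)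
open T4FlagMemory (extd)
open T4HistoryLipschitzRecursion (prodModuli ScaleZeroFree AdmissibleTerms AdmRestrict ChannelAdditive ChannelStepSum
  ChannelSizeAtStepNN)
open T4HistoryLipschitzOuter (Factorises)
open T4HistoryLipschitzActivity (ClusterGeom)
open T4HistoryLipschitzSegment (TwoPointKP)
open T4InputCauchyRateData (StepModel)
open T4OperatorRateLiaison (EntrywiseRate)
open NE9LastCouplingBridge (ne9_and_fadingMemory_of_couplingTwoPoint)
open OutputRateResidual (ne5_at_of_entrywise_lip_nat)
open NE9CouplingTwoPoint (formAct)
open NE9LocalTwoPoint (cutoffLF)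
open NE9DilatedTables (smallFieldPolydisc dilationDomain dilTables)
open NE9TiltedProduct (tiltConst)
open NE4GaussianCouplingTwoPoint (couplingTwoPoint_of_gaussian)
open NE4ReadOutSocketGaussian (injectedRate_of_gaussNE9_endNE5)

variable {C : Carriers} {ι X : Type}

/-! ## §0 Node U3 along the tower on t-histories, from the sibling nodes' typed outputs (no γ³) -/

/-- **TERM-WISE MATCHING FROM THE SIBLING NODES' TYPED OUTPUTS ON t-HISTORIES (`K`-uniform constant).**  The t-analogue of
`T4TowerRateDischarge.uRateUpTo_of_nodes`: NE9 ∧ FadingMemory for a t-parametrised run-A family `Et` over `Wt`, node U1b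
(`LipBackground Et Wt κ CU` with `PolyLipGrowth CU` on the t-runs), NE5 for the pair (`Et`, `EBt`) over `Wt`, nodes U5/U6
(`LocalRate R C₃ θ₃`, `GaugeDominated R uA uB`), node U2's output `InjectedRate Cd 0 θc (disc of the runs)` — which IS the
coupling rate of the t-runs `n ↦ (g K n)⁻²` vs `n ↦ (g (K+1) (n+1))⁻²` with constant `Cd` itself
(`T4CurrencyMatching.couplingRateT_of_injectedDisc`) —, the t-runs in `Wt`, and a target rate `θ′ > max ω θc`, `θ₅, θ₃ ≤ θ′`
give `∃ a ≥ 0, ∀ K, URateUpTo K Et EBt (t-run A) (t-run B) (uA K) (uB K) R.dom (a + C₉·Cd·θ′/(θ′ − max ω θc) + C₅) θ′ κ`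
(`uRateUpTo_tower_anyRate` BY NAME; `a` from `argBracket_tower`).  Bookkeeping over UNPRINTED cell shapes. [folklore] -/
theorem uRateUpToT_of_nodes {R : Readings ι X} {Wt : Set (ℕ → ℝ)} {Et : Functional C C.BgA} {EBt : Functional C C.BgB}
    {κ θ₅ C₅ C₉ ω θc Cd C₃ θ₃ P θ' : ℝ} {q : ℕ} {Λ : ℕ → ℕ → ℝ} {CU : (ℕ → ℝ) → ℕ → ℝ} {g : ℕ → ℕ → ℝ}
    {uA : ℕ → ι → C.BgA} {uB : ℕ → ι → C.BgB}
    (h9 : NE9 Et Wt κ Λ) (hΛ : T4OutputRate.FadingMemory C₉ ω Λ) (hω : 0 ≤ ω)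
    (hU : LipBackground Et Wt κ CU) (hG : PolyLipGrowth CU (fun K n => invSq (g K n)) P q) (hP : 0 ≤ P)
    (h5 : NE5 Et EBt Wt κ θ₅ C₅) (hθ₅ : 0 ≤ θ₅) (hC₅ : 0 ≤ C₅)
    (hloc : LocalRate R C₃ θ₃) (hC₃ : 0 ≤ C₃) (hθ₃ : 0 ≤ θ₃) (hθ₃1 : θ₃ < 1) (hgd : GaugeDominated R uA uB)
    (hinj : InjectedRate Cd 0 θc (fun K j => disc (g K) (g (K + 1)) j)) (hCd : 0 ≤ Cd) (hθc : 0 ≤ θc)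
    (htA : ∀ K, (fun n => invSq (g K n)) ∈ Wt) (htB : ∀ K, (fun n => invSq (g (K + 1) (n + 1))) ∈ Wt)
    (hθ' : max ω θc < θ') (hθ₅' : θ₅ ≤ θ') (hθ₃' : θ₃ ≤ θ') :
    ∃ a : ℝ, 0 ≤ a ∧ ∀ K, URateUpTo K Et EBt (fun n => invSq (g K n)) (fun n => invSq (g (K + 1) (n + 1))) (uA K) (uB K)
      R.dom (a + C₉ * Cd * (θ' / (θ' - max ω θc)) + C₅) θ' κ := by
  have hclose := closeness_of_localRate (C := C) hloc hgd
  obtain ⟨a, ha0, harg⟩ := argBracket_tower (δc := fun K => C₃ * θ₃ ^ K) hG hP hC₃ hθ₃ hθ₃1 hθ₃'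
    (fun K => by positivity) (fun K => le_rfl)
  refine ⟨a, ha0, fun K => ?_⟩
  exact uRateUpTo_tower_anyRate (gA := fun K n => invSq (g K n)) (gB := fun K n => invSq (g (K + 1) (n + 1)))
    (Adm := fun _ => R.dom) (δc := fun K => C₃ * θ₃ ^ K) h9 hΛ hU h5 hω hθc hθ₅ (hθ₃.trans hθ₃') hC₅ hCd ha0 hθ' hθ₅'
    le_rfl htA htB (fun K i hi => couplingRateT_of_injectedDisc hinj K i hi) hclose (fun K j hj => (hG K j hj).1) harg K

/-! ## §1 Row NE4 in the spine on t-histories, node U2 fed by the Gaussian coupling channel, END to END -/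

/-- **ROW NE4 IN THE SPINE ON t-HISTORIES — `URateUpTo K`, `K`-UNIFORM, WITH NODE U2 FED BY ROW NE9's END (COUPLING
CHANNEL PRODUCED FROM GAUSSIAN LETTERS) AND ROW NE5's END, BY NAME.**  §0 with: `h9`/`hΛ` := row NE9's END on (GAUSS) +
its remaining binders; `hinj` := `NE4ReadOutSocketGaussian.injectedRate_of_gaussNE9_endNE5` (all its binders: (GAUSS),
NE9-rest, NE5-END for the READ-OUT FAMILY (`reparam invSq Et`, `EBfam b′`) over `W` through `Mf b′`, (R) on classes,
runs/box/pin, memory gap `ν < ρ`, the weight-1 window); `h5` := row NE5's END for the TOWER PAIR (`Et`, `EBt`) over `Wt`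
through ONE step model `M` (MI-R `hrA`/`hrB`/`hbase`, W2 `hlip5`, decay `hdAt`/`hdB`, W1 `hent`/`hfl`, W4 `hins`, W3 `hdamp`;
scalars shared with the family); node U1b `hU`/`hG`/`hP` on the t-runs; nodes U5/U6 `hloc`/`hgd`; the t-runs in `Wt`
(`htA`/`htB`); target rate `θ′ > max ν ρ`, `θ₅, θ₃ ≤ θ′`.  Constant `a + (ℓ/ν)·(2(cr·C₅·θ₅)/(1 − ρ))·θ′/(θ′ − max ν ρ) +
C₅`, `a ≥ 0` from the argument bracket — the g-currency's `γ³` (`NE4ReadOutSocket.uRateUpTo_of_endNE9_endNE5`) is absent.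
What node U2 displays after this: see the module header. [folklore] -/
theorem uRateUpToT_of_gaussNE9_endNE5 (G : ClusterGeom C) {Pot : Type*} [NormedAddCommGroup Pot] [NormedSpace ℂ Pot]
    -- ===== (GAUSS) the Gaussian letters of the coupling channel, per index =====
    {ED : G.P → Type*} [∀ p, NormedAddCommGroup (ED p)] [∀ p, InnerProductSpace ℝ (ED p)]
    [∀ p, FiniteDimensional ℝ (ED p)] [∀ p, MeasurableSpace (ED p)] [∀ p, BorelSpace (ED p)]
    {TT : ℕ → C.BgA → (p : G.P) → ED p →ₗ[ℝ] ED p} (hT : ∀ k U p, (TT k U p).IsSymmetric) {nD : G.P → ℕ}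
    (hn : ∀ p, Module.finrank ℝ (ED p) = nD p) {Bd : G.P → Type*} [∀ p, DecidableEq (Bd p)]
    {sb lb ab : (p : G.P) → Finset (Bd p)} (ub : ℕ → C.BgA → (p : G.P) → Bd p → ED p)
    {Wc : G.P → Type*} [∀ p, NormedAddCommGroup (Wc p)] [∀ p, NormedSpace ℂ (Wc p)] {Vc : Type*} [NormedAddCommGroup Vc]
    [NormedSpace ℂ Vc] {φc : ℕ → C.BgA → (p : G.P) → ED p → Wc p} {ℓc : (p : G.P) → Bd p → Wc p →L[ℂ] Vc} {TM : Type*}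
    {terms : G.P → Finset TM} {ac : TM → ℂ → ℂ} {F : ℕ → C.BgA → Pot → (p : G.P) → TM → Wc p → ℂ}
    {pre : ℕ → C.BgA → Pot → (p : G.P) → ED p → ℂ} {e e₁ : ℕ → C.BgA → Pot → (p : G.P) → ED p → ℝ}
    {hh : ℕ → C.BgA → Pot → (p : G.P) → ED p} {α M₀ M₁ : ℕ → C.BgA → Pot → G.P → ℝ} {ε₁ c γ : ℝ}
    {𝒜 : ℕ → Set Pot} {Idx : ℕ → C.BgA → Pot → G.P → Prop} {Wt : Set (ℕ → ℝ)}
    {act : ℕ → ℝ → C.BgA → Pot → G.P → ℂ} {n : ℕ → ℝ → C.BgA → G.P → ℝ} {clip : ℕ → ℝ}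
    (hIdx : ∀ (k : ℕ) (U : C.BgA) (X : C.Dom), C.scale X = k + 1 → ∀ Q ∈ 𝒜 k, ∀ p ∈ G.vol X, Idx k U Q p)
    (hact : ∀ k t U Q p, act k t U Q p = formAct (stdGaussian (ED p))
      (cutoffLF (sb p) (lb p) (fun b (z : ED p) => ⟪ub k U p b, TT k U p z⟫) ε₁) (pre k U Q p)
      (fun x z => dilTables (terms p) ac (F k U Q p) (φc k U p) x z) (Real.sqrt t)⁻¹)
    (hWtfloor : ∀ g ∈ Wt, ∀ k, (γ ^ 2)⁻¹ ≤ g k) (hε : 0 ≤ ε₁) (hc : 0 < c) (hγ : 0 < γ) (hab : ∀ p, ab p ⊆ sb p)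
    (ha : ∀ s s', 0 < s → s ≤ γ → 0 < s' → s' ≤ γ →
      ∀ m, DifferentiableOn ℂ (ac m) (dilationDomain (min s s') (max s s') (c * min s s')))
    (hα0 : ∀ k U Q p, Idx k U Q p → 0 ≤ α k U Q p)
    (hα : ∀ k U Q p, Idx k U Q p → ∀ i, α k U Q p * ((hT k U p).eigenvalues (hn p) i) ^ 2 < 1)
    (hub : ∀ k U Q p, Idx k U Q p → ∀ b ∈ sb p ∪ lb p, TT k U p (ub k U p b) ≠ 0)
    (hprem : ∀ k U Q p, Idx k U Q p → Measurable (pre k U Q p))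
    (hem : ∀ k U Q p, Idx k U Q p → Measurable (e k U Q p)) (he₁m : ∀ k U Q p, Idx k U Q p → Measurable (e₁ k U Q p))
    (hVs : ∀ k U Q p, Idx k U Q p → ∀ s, 0 < s → s ≤ γ →
      AEStronglyMeasurable (fun z => dilTables (terms p) ac (F k U Q p) (φc k U p) s z) (stdGaussian (ED p)))
    (he₁ : ∀ k U Q p, Idx k U Q p → ∀ z, 0 ≤ e₁ k U Q p z)
    (hM₀ : ∀ k U Q p, Idx k U Q p → 0 ≤ M₀ k U Q p) (hM₁ : ∀ k U Q p, Idx k U Q p → 0 ≤ M₁ k U Q p)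
    (hlink : ∀ k U Q p, Idx k U Q p → ∀ z, ∀ b ∈ ab p, ‖ℓc p b (φc k U p z)‖ ≤ |⟪ub k U p b, TT k U p z⟫|)
    (hF : ∀ k U Q p, Idx k U Q p → ∀ m ∈ terms p,
      DifferentiableOn ℂ (F k U Q p m) (smallFieldPolydisc (ab p) (ℓc p) ((1 + c) * ε₁)))
    (hbd : ∀ k U Q p, Idx k U Q p → ∀ s, 0 < s → s ≤ γ →
      ∀ z ∈ cutoffLF (sb p) (lb p) (fun b (z : ED p) => ⟪ub k U p b, TT k U p z⟫) ε₁ s,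
        ‖dilTables (terms p) ac (F k U Q p) (φc k U p) s z‖ ≤ e k U Q p z)
    (hdil : ∀ k U Q p, Idx k U Q p → ∀ s s', 0 < s → s ≤ γ → 0 < s' → s' ≤ γ →
      ∀ z ∈ cutoffLF (sb p) (lb p) (fun b (z : ED p) => ⟪ub k U p b, TT k U p z⟫) ε₁ s ∩
          cutoffLF (sb p) (lb p) (fun b (z : ED p) => ⟪ub k U p b, TT k U p z⟫) ε₁ s',
        ∀ ζ ∈ dilationDomain (min s s') (max s s') (c * min s s'),
          ‖dilTables (terms p) ac (F k U Q p) (φc k U p) ζ z‖ ≤ e₁ k U Q p z)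
    (hdom₀ : ∀ k U Q p, Idx k U Q p → ∀ z, ‖pre k U Q p z‖ * Real.exp (e k U Q p z) ≤
      M₀ k U Q p * Real.exp (α k U Q p / 2 * ‖TT k U p z‖ ^ 2 + ⟪hh k U Q p, TT k U p z⟫))
    (hdom₁ : ∀ k U Q p, Idx k U Q p → ∀ z, ‖pre k U Q p z‖ * e₁ k U Q p z * Real.exp (e k U Q p z) ≤
      M₁ k U Q p * Real.exp (α k U Q p / 2 * ‖TT k U p z‖ ^ 2 + ⟪hh k U Q p, TT k U p z⟫))
    (hsize : ∀ k U Q p, Idx k U Q p → ∀ t', (γ ^ 2)⁻¹ ≤ t' →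
      M₀ k U Q p * ∏ i, tiltConst (α k U Q p * ((hT k U p).eigenvalues (hn p) i) ^ 2)
        ((hT k U p).eigenvalues (hn p) i * ⟪hh k U Q p, (hT k U p).eigenvectorBasis (hn p) i⟫) ≤ n k t' U p)
    (hmod : ∀ k U Q p, Idx k U Q p → ∀ t', (γ ^ 2)⁻¹ ≤ t' →
      4 * (M₁ k U Q p * ∏ i, tiltConst (α k U Q p * ((hT k U p).eigenvalues (hn p) i) ^ 2)
            ((hT k U p).eigenvalues (hn p) i * ⟪hh k U Q p, (hT k U p).eigenvectorBasis (hn p) i⟫)) / c * (γ ^ 2 / 2) +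
        (∑ b ∈ sb p ∪ lb p, M₀ k U Q p *
            (∏ i, tiltConst (α k U Q p * ((hT k U p).eigenvalues (hn p) i) ^ 2)
              ((hT k U p).eigenvalues (hn p) i * ⟪hh k U Q p, (hT k U p).eigenvectorBasis (hn p) i⟫)) *
            (2 * ε₁ * (Real.sqrt (2 * Real.pi * ‖TT k U p (ub k U p b)‖ ^ 2))⁻¹)) * (γ / 2) ≤
        clip k * n k t' U p)
    -- ===== (NE9-END, rest) the other binders of `ne9_and_fadingMemory_of_couplingTwoPoint`, on t-histories =====
    {ιc : Type} {Et : Functional C C.BgA} {Adm : Set (C.BgA → C.Dom → ℝ)}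
    {Tc : ℕ → (ℕ → ℝ) → (C.BgA → C.Dom → ℝ) → ιc → ℝ} {Ψ : ℕ → ℝ → (ιc → ℝ) → C.BgA → C.Dom → ℝ}
    {lip : ℕ → ℝ} {aP dP : G.P → ℝ} {δ : C.Dom → ℝ} {κ B lipbar clipbar pexbar qTbar τbar ω ℓ ν : ℝ}
    {wt : ℕ → ιc → ℝ} {τ : ℕ → ℕ → ℝ} {pex qT : ℕ → ℝ} (ρT : ℕ → (ιc → ℝ) → Pot)
    (expl : ℕ → ℝ → C.BgA → C.Dom → ℝ)
    (h0 : ScaleZeroFree Et Wt) (hAdm : AdmissibleTerms Et Wt Adm) (hres : AdmRestrict Adm) (hadd : ChannelAdditive Adm Tc)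
    (hsum : ChannelStepSum Adm Tc) (hstep : ChannelSizeAtStepNN Adm Tc κ wt τ) (hfac : Factorises Et Wt Tc Ψ)
    (hclip0 : ∀ k, 0 ≤ clip k) (hqT0 : ∀ k, 0 ≤ qT k)
    (hTcup : ∀ g ∈ Wt, ∀ g' ∈ Wt, ∀ (k : ℕ) (y : ιc), |Tc k g (Et g) y - Tc k g' (Et g) y| ≤ wt k y * (qT k * |g k - g' k|))
    (hrepr : ∀ (k : ℕ) (s : ℝ) (P : ιc → ℝ) (U : C.BgA) (X : C.Dom),
      Ψ k s P U X = (G.newTerm act k s U X (ρT k P)).re + expl k s U X)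
    (hexpl : ∀ g ∈ Wt, ∀ g' ∈ Wt, ∀ (k : ℕ) (U : C.BgA) (X : C.Dom), C.scale X = k + 1 →
      |expl k (g k) U X - expl k (g' k) U X| ≤ Real.exp (-(κ * C.d X)) * (pex k * |g k - g' k|))
    (hclipb : ∀ k, clip k ≤ clipbar) (hpexb : ∀ k, pex k ≤ pexbar) (hpexbar : 0 ≤ pexbar) (hqTb : ∀ k, qT k ≤ qTbar)
    (hKP : TwoPointKP G Wt act 𝒜 n lip aP dP) (hdec : G.DecayExtract δ dP) (hpinB : G.PinBudget aP δ (fun _ => B) κ)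
    (hρT : ∀ (k : ℕ) (P P' : ιc → ℝ) (M : ℝ), (∀ y, |P y - P' y| ≤ wt k y * M) → ‖ρT k P - ρT k P'‖ ≤ M)
    (hocc : ∀ g ∈ Wt, ∀ g' ∈ Wt, ∀ k : ℕ, ρT k (Tc k g' (Et g)) ∈ 𝒜 k) (hB0 : 0 ≤ B)
    (hlipb : ∀ k, lip k ≤ lipbar) (hτbar : 0 ≤ τbar) (hω : 0 ≤ ω) (hpos : 0 < ω + 4 * lipbar * B * τbar)
    (hτ : ∀ k j, j ≤ k → 0 ≤ τ k j ∧ τ k j ≤ τbar * ω ^ (k - j))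
    (hℓ : 4 * clipbar * B + pexbar + 4 * lipbar * B * qTbar = ℓ) (hν : ω + 4 * lipbar * B * τbar = ν)
    -- ===== (NE5-END) for the read-out family (`reparam invSq Et`, `EBfam b′`) over the coupling window `W` =====
    {S Hist : Type*} [Fintype S] [NormedAddCommGroup Hist] [NormedSpace ℂ Hist] (Mf : ℝ → StepModel C (S → ℂ) Hist)
    {W : Set (ℕ → ℝ)} {EBfam : ℝ → Functional C C.BgB} {Λ₅ EA₀ E₀ c₁ r₀ δ₅ θ₁ θ₅ c₅ ω₅ ρ₀ B₅ C₅ : ℝ} {rf : ℕ → S → ℝ}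
    {k₅ : ℕ} (hdA : DecayBound (reparam invSq Et) W EA₀ κ) (hunit : ∀ k s, rf k s ≤ θ₁ ^ k) (hr₀ : 0 < r₀)
    (hc₁ : 0 ≤ c₁) (hrAf : ∀ b', 0 < b' → b' ≤ γ → (Mf b').RepresentsA (reparam invSq Et) W)
    (hrBf : ∀ b', 0 < b' → b' ≤ γ → (Mf b').RepresentsB (EBfam b') W)
    (hbasef : ∀ b', 0 < b' → b' ≤ γ → (Mf b').InBase (EBfam b') W)
    (hlipf : ∀ b', 0 < b' → b' ≤ γ → (Mf b').DataLipschitz W κ Λ₅ ρ₀)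
    (hdBf : ∀ b', 0 < b' → b' ≤ γ → DecayBound (EBfam b') W E₀ κ)
    (hentf : ∀ b', 0 < b' → b' ≤ γ → EntrywiseRate (Mf b') W c₁ rf)
    (hflf : ∀ b', 0 < b' → b' ≤ γ → ∀ k, r₀ ≤ (Mf b').rOp k)
    (hinsf : ∀ b', 0 < b' → b' ≤ γ → (Mf b').InsertionRate W κ E₀ δ₅ θ₁)
    (hdampf : ∀ b', 0 < b' → b' ≤ γ → (Mf b').InsertionDampedNat W κ c₅ ω₅)
    (hΛ₅ : 0 ≤ Λ₅) (hδ₅ : 0 ≤ δ₅) (hθ₁ : 0 ≤ θ₁) (hθ₁₅ : θ₁ ≤ θ₅) (hθ₅1 : θ₅ ≤ 1) (hc₅ : 0 ≤ c₅) (hω₅ : 0 < ω₅)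
    (hnear : (c₁ / r₀ + δ₅) * θ₁ ^ k₅ + c₅ * (EA₀ + E₀) / (1 - ω₅) ≤ ρ₀) (hB₅ : 0 ≤ B₅)
    (hfirst : ∀ k < k₅, EA₀ + E₀ ≤ B₅ * θ₁ ^ k) (hsmall5 : ω₅ + Λ₅ * c₅ < θ₅)
    (hC₅ : (Λ₅ * (c₁ / r₀ + δ₅) + B₅) * (θ₅ - ω₅) / (θ₅ - (ω₅ + Λ₅ * c₅)) = C₅)
    -- ===== node U2's read-out (R) on classes, β read from the t-parametrised family =====
    {𝒜A : Set (Slice C C.BgA)} {𝒜B : Set (Slice C C.BgB)} {rA : ReadOut C C.BgA} {rB : ReadOut C C.BgB} {β : HBeta}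
    {cr : ℝ} (hW : ∀ k (v : Fin (k + 1) → ℝ), v ∈ Box γ k → extd v ∈ W)
    (hWt : ∀ k (v : Fin (k + 1) → ℝ), v ∈ Box γ k → (fun m => invSq (extd v m)) ∈ Wt)
    (hA : RepresentsA (reparam invSq Et) rA γ β) (hB : RepresentsB EBfam rB γ β)
    (h𝒜A : ∀ g' ∈ W, reparam invSq Et g' ∈ 𝒜A) (h𝒜B : ∀ b', 0 < b' → b' ≤ γ → ∀ g' ∈ W, EBfam b' g' ∈ 𝒜B)
    (hr : ReadBoundedOn 𝒜A rA κ cr) (hcov : ReadCovariantOn 𝒜A 𝒜B rA rB κ cr) (hcr : 0 ≤ cr)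
    -- ===== node U1/H3's runs, the rates and the window (weight 1) =====
    {ρ : ℝ} (g : ℕ → ℕ → ℝ) (gIR : ℝ) (hθ₅ρ : θ₅ ≤ ρ) (hνρ : ν < ρ) (hρ0 : 0 < ρ) (hρ1 : ρ < 1)
    (hrun : ∀ K, RGEqH K β (g K)) (hbox : ∀ K i, i ≤ K → 0 < g K i ∧ g K i ≤ γ) (hpin : ∀ K, g K K = gIR)
    (hsmall : cr * (ℓ / ν) * ν * (ρ / (ρ - ν)) ≤ (1 - ρ) / 2)
    -- ===== row NE5's END for the TOWER PAIR (`Et`, `EBt`) over `Wt` through ONE step model `M` =====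
    (M : StepModel C (S → ℂ) Hist) {EBt : Functional C C.BgB} (hrA : M.RepresentsA Et Wt) (hrB : M.RepresentsB EBt Wt)
    (hbase : M.InBase EBt Wt) (hlip5 : M.DataLipschitz Wt κ Λ₅ ρ₀) (hdAt : DecayBound Et Wt EA₀ κ)
    (hdB : DecayBound EBt Wt E₀ κ) (hent : EntrywiseRate M Wt c₁ rf) (hfl : ∀ k, r₀ ≤ M.rOp k)
    (hins : M.InsertionRate Wt κ E₀ δ₅ θ₁) (hdamp : M.InsertionDampedNat Wt κ c₅ ω₅)
    -- ===== node U1b on the t-runs, nodes U5/U6, the t-runs in `Wt`, the target rate =====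
    {R : Readings ι X} {C₃ θ₃ P θ' : ℝ} {q : ℕ} {CU : (ℕ → ℝ) → ℕ → ℝ} {uA : ℕ → ι → C.BgA} {uB : ℕ → ι → C.BgB}
    (hU : LipBackground Et Wt κ CU) (hG : PolyLipGrowth CU (fun K n => invSq (g K n)) P q) (hP : 0 ≤ P)
    (hloc : LocalRate R C₃ θ₃) (hC₃ : 0 ≤ C₃) (hθ₃ : 0 ≤ θ₃) (hθ₃1 : θ₃ < 1) (hgd : GaugeDominated R uA uB)
    (htA : ∀ K, (fun n => invSq (g K n)) ∈ Wt) (htB : ∀ K, (fun n => invSq (g (K + 1) (n + 1))) ∈ Wt)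
    (hθ' : max ν ρ < θ') (hθ₅' : θ₅ ≤ θ') (hθ₃' : θ₃ ≤ θ') :
    ∃ a : ℝ, 0 ≤ a ∧ ∀ K, URateUpTo K Et EBt (fun n => invSq (g K n)) (fun n => invSq (g (K + 1) (n + 1))) (uA K) (uB K)
      R.dom (a + ℓ / ν * (2 * (cr * C₅ * θ₅) / (1 - ρ)) * (θ' / (θ' - max ν ρ)) + C₅) θ' κ := by
  subst hℓ hν hC₅
  have hK := ne9_and_fadingMemory_of_couplingTwoPoint G ρT expl h0 hAdm hres hadd hsum hstep hfac hclip0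
    (couplingTwoPoint_of_gaussian G hT hn ub hIdx hact hWtfloor hε hc hγ hab ha hα0 hα hub hprem hem he₁m hVs he₁ hM₀ hM₁
      hlink hF hbd hdil hdom₀ hdom₁ hsize hmod)
    hqT0 hTcup hrepr hexpl hclipb hpexb hpexbar hqTb hKP hdec hpinB hρT hocc hB0 hlipb hτbar hω hpos hτ
  have hC₅nn := NE4ReadOutSocket.ne5Const_nonneg hΛ₅ hδ₅ hr₀ hc₁ hc₅ hB₅ hsmall5
  have h5t := ne5_at_of_entrywise_lip_nat M hrA hrB hbase hlip5 hdAt hdB hent hunit hfl hr₀ hc₁ hins hdamp hΛ₅ hδ₅ hθ₁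
    hθ₁₅ hθ₅1 hc₅ hω₅ hnear hB₅ hfirst hsmall5
  have hinj := injectedRate_of_gaussNE9_endNE5 G hT hn ub hIdx hact hWtfloor hε hc hγ hab ha hα0 hα hub hprem hem he₁m
    hVs he₁ hM₀ hM₁ hlink hF hbd hdil hdom₀ hdom₁ hsize hmod ρT expl h0 hAdm hres hadd hsum hstep hfac hclip0 hqT0 hTcup
    hrepr hexpl hclipb hpexb hpexbar hqTb hKP hdec hpinB hρT hocc hB0 hlipb hτbar hω hpos hτ rfl rfl Mf hdA hunit hr₀ hc₁
    hrAf hrBf hbasef hlipf hdBf hentf hflf hinsf hdampf hΛ₅ hδ₅ hθ₁ hθ₁₅ hθ₅1 hc₅ hω₅ hnear hB₅ hfirst hsmall5 rfl hW hWt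
    hA hB h𝒜A h𝒜B hr hcov hcr g gIR hθ₅ρ hνρ hρ0 hρ1 hrun hbox hpin hsmall
  exact uRateUpToT_of_nodes hK.1 hK.2 hpos.le hU hG hP h5t (hθ₁.trans hθ₁₅) hC₅nn hloc hC₃ hθ₃ hθ₃1 hgd hinj
    (div_nonneg (mul_nonneg zero_le_two (mul_nonneg (mul_nonneg hcr hC₅nn) (hθ₁.trans hθ₁₅))) (by linarith)) hρ0.le
    htA htB hθ' hθ₅' hθ₃'

open scoped Topology
open FlowStep (BetaContH mem_box)
open T4CurrencyMatching (HistLipschitzT logT CurrencyWeight)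

/-! ## §2 The headline's continuity binder (C) from the t-triple (node U2's input in ANY continuous currency) -/

/-- **HISTORY MODULI IN A CONTINUOUS CURRENCY GIVE THE HEADLINE's BINDER (C).**  If `|β_{k+1}(p) − β_{k+1}(q)| ≤ Σ_{i≤k} Λ k i ·
|φ(p_i) − φ(q_i)|` on the box ]0,γ]^{k+1} (`T4CurrencyMatching.HistLipschitzBy φ Λ γ β`, node U2's NE9-fed input in the
currency `φ`; NOT PRINTED) and `φ` is merely CONTINUOUS on ]0,γ] (no Lipschitz bound, no sign on the moduli), then every `β_{k+1}`
is continuous on its box: `FlowStep.BetaContH γ β` = the binder `hC` of `T4ContinuumYM4Torus.continuumYM4_torus_of_BetaPertH`.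
Proof: squeeze `|β k p − β k q| ≤ Σ |Λ k i|·|φ(p_i) − φ(q_i)| → 0` as `p → q` inside the box.  (The g-currency case `φ = id` is
`T4BetaStationary.betaContH_of_histLipschitz`; that lemma does NOT cover `φ = invSq`, whose moduli are not g-Lipschitz at the
vertex — `T4CurrencyMatching.histLipschitzT_of_histLipschitz`, converse false.) [folklore] -/
theorem betaContH_of_histLipschitzBy {φ : ℝ → ℝ} {Λ : ℕ → ℕ → ℝ} {γ : ℝ} {β : HBeta}
    (hL : HistLipschitzBy φ Λ γ β) (hφ : ContinuousOn φ (Set.Ioc 0 γ)) : BetaContH γ β := by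
  intro k q hq
  -- the majorant `G p = Σ |Λ k i| · |φ (p i) − φ (q i)|` is continuous on the box and vanishes at `q`
  have hcoord : ∀ i : Fin (k + 1), ContinuousOn (fun p : Fin (k + 1) → ℝ => φ (p i)) (Box γ k) := fun i =>
    hφ.comp (continuous_apply i).continuousOn fun p hp => by
      have h := (mem_box.mp hp) i
      exact ⟨h.1, h.2⟩
  have hG : ContinuousOn (fun p : Fin (k + 1) → ℝ => ∑ i : Fin (k + 1), |Λ k i| * |φ (p i) - φ (q i)|) (Box γ k) :=
    continuousOn_finsetSum _ fun i _ => continuousOn_const.mul ((hcoord i).sub continuousOn_const).abs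
  have hG0 : Filter.Tendsto (fun p : Fin (k + 1) → ℝ => ∑ i : Fin (k + 1), |Λ k i| * |φ (p i) - φ (q i)|)
      (𝓝[Box γ k] q) (𝓝 0) := by
    simpa using (hG q hq).tendsto
  -- squeeze
  rw [ContinuousWithinAt, tendsto_iff_norm_sub_tendsto_zero]
  refine squeeze_zero' (Filter.Eventually.of_forall fun p => norm_nonneg _) ?_ hG0
  filter_upwards [self_mem_nhdsWithin] with p hp
  rw [Real.norm_eq_abs]
  refine (hL k p q hp hq).trans (Finset.sum_le_sum fun i _ => ?_)
  exact mul_le_mul_of_nonneg_right (le_abs_self _) (abs_nonneg _)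

/-- `invSq = (·)⁻²` (the recursion variable `t = 1/g²` of [Balaban1987RG1] (0.20)) is continuous on ]0,γ]. [folklore] -/
theorem continuousOn_invSq_Ioc (γ : ℝ) : ContinuousOn invSq (Set.Ioc 0 γ) :=
  ((continuous_pow 2).continuousOn.inv₀ fun _ hx => pow_ne_zero 2 hx.1.ne').congr fun _ _ => rfl

/-- `logT = log ∘ (·)⁻²` is continuous on ]0,γ]. [folklore] -/
theorem continuousOn_logT_Ioc (γ : ℝ) : ContinuousOn logT (Set.Ioc 0 γ) :=
  ((continuousOn_invSq_Ioc γ).log fun _ hx => (inv_pos.mpr (pow_pos hx.1 2)).ne').congr fun _ _ => rfl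

/-- **THE t-CURRENCY INPUT OF NODE U2 IMPLIES (C).**  `HistLipschitzT Λ γ β` (= `HistLipschitzBy invSq`, the WEAKEST currency:
every currency with a sup weight converts to it, `T4CurrencyMatching.histLipschitzT_of_by`) ⇒ `BetaContH γ β`. [folklore] -/
theorem betaContH_of_histLipschitzT {Λ : ℕ → ℕ → ℝ} {γ : ℝ} {β : HBeta} (hL : HistLipschitzT Λ γ β) : BetaContH γ β :=
  betaContH_of_histLipschitzBy hL (continuousOn_invSq_Ioc γ)

/-- Hence EVERY currency with a sup weight and non-negative moduli gives (C) (via the t-currency). [folklore] -/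
theorem betaContH_of_histLipschitzBy_weight {φ : ℝ → ℝ} {Λ : ℕ → ℕ → ℝ} {γ w : ℝ} {β : HBeta}
    (hL : HistLipschitzBy φ Λ γ β) (hφ : CurrencyWeight φ γ w) (hΛ : ∀ k i, i ≤ k → 0 ≤ Λ k i) : BetaContH γ β :=
  betaContH_of_histLipschitzT (T4CurrencyMatching.histLipschitzT_of_by hL hφ hΛ)

/-- **ROW NE4's t-TRIPLE FEEDS THE HEADLINE's (C).**  From the conclusion SHAPE of `NE4ReadOutSocketGaussian.ne4T_of_gaussNE9_endNE5`
(node U2's triple on t-histories: `ScaleShiftRate c θ γ β ∧ HistLipschitzBy invSq Λ γ β ∧ FadingMemory Cm ν Λ`) the binder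
`hC : FlowStep.BetaContH γ β` of `T4ContinuumYM4Torus.continuumYM4_torus_of_BetaPertH` follows — apply as
`betaContH_of_ne4T (ne4T_of_gaussNE9_endNE5 G hT hn ub …)`.  So the t-currency booking of row NE4 feeds the headline's
continuity binder exactly as the g-currency booking does (`T4BetaStationary.betaContH_of_histLipschitz`); the other β-binder
`hP : FlowStep.BetaPertH` is NOT touched (β sub-cell).  Bookkeeping; NE4 NOT proved (DEPENDENT); 0/9 unchanged. [folklore] -/
theorem betaContH_of_ne4T {c θ γ Cm ν : ℝ} {Λ : ℕ → ℕ → ℝ} {β : HBeta}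
    (h : ScaleShiftRate c θ γ β ∧ HistLipschitzBy invSq Λ γ β ∧ T4CouplingMatching.FadingMemory Cm ν Λ) :
    BetaContH γ β :=
  betaContH_of_histLipschitzT h.2.1

end Summit.QuantumFields.BalabanUV.T4Continuum.NE4ReadOutSocketGaussianSpine

end
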